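import Summits.BirchSwinnertonDyer.Rank1Residual.AdditivePotMult.RamifiedOrdinaryLineMatchingMixed
import Summits.BirchSwinnertonDyer.Rank1Residual.Additive.CongruentPartnerMainConjectureGordEPWTorsionIso
import Summits.BirchSwinnertonDyer.Rank1Residual.Additive.CongruentLambdaShiftOfEPWTorsionIso
import HarnessLib

/-!
# Route G on MIXED (G-ord, e = 2) × (M) congruent pairs, and the (G-ord)-side partner ends, WITH THE
# RAMIFIED ORDINARY LINES DISCHARGED — the X4 consumer square `{X4♯(G-ord, e = 2), X4(M)}²` completed
# (cell `b2b-bsdres`, team n1011, seat p07 (gen 5), OWNERS row T-E3d-MIX; sequel of the TB-ROL files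
# `RamifiedOrdinaryLineMatchingMixed` (C′, p07 gen 4), `GordRamifiedOrdinaryLinePair` /
# `CongruentPartnerMainConjectureGordEPWTorsionIso` (n1011-p10), `PotMultCongruentPartnerEPW[Lines]`)

HONEST FRAMING (cell `b2b-bsdres`, run/shared/lean/b2b/bsd-rank1-residual/, verbatim in every
file): the goal of the cell is to DELETE the COMBINATION-SHAPED residual classes of the
Birch–Swinnerton-Dyer formula for ALL analytic-rank `≤ 1` elliptic curves over `ℚ` — "full BSD
formula for every rank `≤ 1` curve in class `C`" assembled STRICTLY from published theorems — so
that the rank-`≤ 1` remainder becomes exactly the CONSTRUCTION-SHAPED classes, which are TYPED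
(missing-input `Prop`s), NOT attempted. This is not "finishing BSD". Team n1011 (RESIDUAL-MAP §I
N10 / N11 LOWER; Route G's per-pair EPW consumers on X4♯(G-ord, `e = 2`) and X4(M) rows): research
route on CONSTRUCTION-SHAPED items; labels and marks UNCHANGED; nothing booked — every statement
below is PER PAIR modulo the named facts and per-pair inputs outside the kernel (congruence =
census `TorsionIso` currency; `Σ₀`; partner rank; unit coefficient = ENGINE value). Theorems only;
NO definition; NO Literature fact minted. Named facts enter as HYPOTHESES exactly as in the files
consumed, none dropped: `hK` (Kato 2004 Thm. 17.4 (3), half-eigenspace reading), `hEPW`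
(Emerton–Pollack–Weston 2006 Thms. 3.3.2 / 3.3.3 (2) + Lemma 5.1.5), `hmodD` (modular
parametrisation data), and on every statement with an (M) member `hT40`/`hT41` (Silverman *ATAEC*
V.3.1 / V.5.3 / V.5.4, the published Tate uniformisation A40/A41 behind the (M) ramified ordinary
line). Debt 0.

## What and why

Route G's EPW consumers so far cover three corners of the type square at an odd prime `p`:
(G-ord)–(G-ord) (n1011-p10: `ClassX4Gord.mainConjecture_of_katoHalf_of_coeffCert_of_epw_of_torsionIso`,
`ClassX4Gord.congruentLambdaShift_of_epw_of_torsionIso`, with a PER-DATUM partner bound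
`r₁ ≤ λ(X(E₁))`), (M)–(M) (`PotMultCongruentPartnerEPWLines`, partner bound in RANK currency) and
(M) ← (G-ord) (C′ §4 `ClassX4M.budgetLeLambdaAt_of_epw_of_gordTypePartner_of_congr`, partner input
ABSTRACT). This file supplies the rest, as compositions of landed theorems:

* §1 `ClassX4Gord.isTorsion_and_le_lambdaInvariant_of_katoHalf` — an X4♯(G-ord) ∩ `I₀*` ∧ surj(p)
  PARTNER supplies the EPW partner input from Kato's divisibility ALONE, in RANK currency: every
  finitely generated cyclotomic dual datum is torsion, and `μ = 0 ⟹ r₁ ≤ λ` for `r₁ ≤ rank E₁(ℚ)`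
  (twin of FILE 3 §2 `ClassX4M.isTorsion_and_le_lambdaInvariant_of_katoHalf`; no certificate).
* §2 MIXED pairs, both directions: Route G's typed input `CongruentLambdaShift W₁ W₂ p e`,
  `e = Σ_{w∈Σ₀} (δ(E₂,w) − δ(E₁,w))`, and EPW 3.3.2's `μ = 0` transfer, from `hEPW` + a PLAIN
  `TorsionIso` + `E₁[p]` irreducible + `Σ₀` — lines and line-matching by C′
  (`exists_lines_matching_of_typeGOrd_potMult` / `_of_potMult_typeGOrd`).
* §3(M) the BUDGET of an X4(M) row from an X4♯(G-ord) ∩ `I₀*` ∧ surj partner with the partner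
  input CONCRETE (rank currency): `ClassX4M.budgetLeLambdaAt_of_epw_of_gordPartner_of_congr` (C′ §4
  + §1). The (G-ord)-ROW budgets from partners of either type and K-C′ (branch main conjecture) at an
  X4♯(G-ord) row from an X4(M) partner are the sequel `MixedCongruentPartnerEPWGord.lean`.

Net effect: on EVERY X4 pair type at odd `p` (`p = 3` included) the per-pair residual inputs of Route
G are the SAME list — ONE unit coefficient at `E` (record), a plain congruence `E[p] ≅ E₁[p]`, `Σ₀`,
and a partner of either type with `rank E₁(ℚ) ≥ r₁` and `ρ̄_{E₁,p}` onto.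

What is NOT claimed: X3♯ twins (EPW needs `E[p]` irreducible — r2's ARM α); `e ∈ {3,4,6}` rows;
pairs with a SEMISTABLE member (no transport in print, cc-typer-1 N11/TRANSPORT v5); `r_an = 1`
ends; `p = 2`. X4♯(G-ord) / X4(M) stay CONSTRUCTION-SHAPED; nothing booked.

References: M. Emerton, R. Pollack, T. Weston, Invent. Math. 163 (2006) pp. 2–3, Thms. 3.3.2,
3.3.3, Lemma 5.1.5 [EmertonPollackWeston2006]; K. Kato, Astérisque 295 (2004) Thm. 17.4 (3)
[Kato2004Asterisque]; R. Greenberg, V. Vatsal, Invent. Math. 142 (2000) Thm. (1.4), §2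
[GreenbergVatsal2000]; R. Greenberg, LNM 1716 (1999) §3 Lemma 3.1 [GreenbergLNM1716];
J. H. Silverman, *ATAEC* V.5.3–5.4 [SilvermanATAEC1994]; L. Washington, GTM 83 §13.2 [Washington1997].
-/

set_option autoImplicit false

noncomputable section

open scoped Classical MatrixGroups ModularForm NumberField

open CongruenceSubgroup WeierstrassCurve NumberField IsDedekindDomain Field
  Literature.NumberTheory.EllipticCurves
  Literature.NumberTheory.EllipticCurves.ModularForms
  Literature.NumberTheory.EllipticCurves.Rank1Residual
  Literature.NumberTheory.EllipticCurves.Rank1Residual.Typed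
  Literature.NumberTheory.EllipticCurves.GreenbergSelmer
  Literature.NumberTheory.EllipticCurves.Wuthrich2014
  Literature.NumberTheory.EllipticCurves.GreenbergVatsal2000
  Literature.NumberTheory.EllipticCurves.EmertonPollackWeston2006
  Literature.NumberTheory.GaloisRepresentations
  Summit.BirchSwinnertonDyer.Rank1Residual.X1.MuLambda
  Summit.BirchSwinnertonDyer.Rank1Residual.X11a
  Summit.BirchSwinnertonDyer.Rank1Residual.Iwasawa

open Summit.BirchSwinnertonDyer.Rank1Residual.X1.CongruenceTransfer (TorsionIso CongruentLambdaShift)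
open Summit.BirchSwinnertonDyer.Rank1Residual.AdditivePotMult.RamifiedOrdinaryLineMatchingMixed
  (exists_lines_matching_of_typeGOrd_potMult exists_lines_matching_of_potMult_typeGOrd)

/-! ### §0 The place `v_p` -/

namespace Summit.BirchSwinnertonDyer.Rank1Residual.AdditivePotMult

/-- The place `v_p` of `ℚ` above the prime `p` (for statements whose conclusion does not mention a
place). [folklore] -/
theorem MixedCongruentPartnerEPW.exists_place (p : ℕ) [hp : Fact p.Prime] :
    ∃ v : HeightOneSpectrum (𝓞 ℚ), ((p : ℕ) : 𝓞 ℚ) ∈ v.asIdeal :=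
  ⟨(Rat.HeightOneSpectrum.primesEquiv (R := 𝓞 ℚ)).symm ⟨p, hp.out⟩,
    (natCast_mem_asIdeal_iff_eq_primesEquiv_symm _ hp.out).mpr rfl⟩

end Summit.BirchSwinnertonDyer.Rank1Residual.AdditivePotMult

open Summit.BirchSwinnertonDyer.Rank1Residual.AdditivePotMult.MixedCongruentPartnerEPW (exists_place)

/-! ### §1 An X4♯(G-ord) ∩ `I₀*` ∧ surj(p) partner supplies the EPW partner input from Kato ALONE -/

namespace Summit.BirchSwinnertonDyer.Rank1Residual.Additive

open Summit.BirchSwinnertonDyer.Rank1Residual.AdditivePotMult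

variable {W₁ : WeierstrassCurve ℚ} [W₁.IsElliptic] [W₁.IsGloballyMinimal] {p : ℕ} [hp : Fact p.Prime]

/-- **(G-ord, `e = 2`) ∧ surj(p) partner, EVERY odd `p`: torsion and `μ = 0 ⟹ r₁ ≤ λ` with NO
certificate.** For `W₁` in X4♯(G-ord) ∩ `I₀*` (`semistabilityIndex W₁ p = 2`) with `ρ̄_{E₁,p}` onto,
the modular parametrisation (`hmodD`) and Kato's divisibility (`hK`): every finitely generated
cyclotomic dual datum `D₁` of `Sel_{p^∞}(E₁/ℚ_∞)` is TORSION (the full-series brick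
`isTorsion_and_exists_iota_eq_branch_of_katoComponent` on the good-ordinary `p*`-twist model, tower
from surj by `ClassX4Gord.towerSurj_of_surj`), and `μ(X₁) = 0 ⟹ r₁ ≤ λ(X₁)` for every
`r₁ ≤ rank E₁(ℚ)` (a generator of unit content by Greenberg–Vatsal (1) ⟺ (2), then `T^{rank} ∣ char`,
`le_lambdaInvariant_of_le_mordellWeilRank`). Exactly the partner hypothesis `h₁` of
`budgetLeLambdaAt_of_epw_of_partnerRank`; the (G-ord) twin of
`ClassX4M.isTorsion_and_le_lambdaInvariant_of_katoHalf`.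
[cite: Kato2004Asterisque, Thm. 17.4 (3) (p. 273)] [cite: GreenbergVatsal2000, p. 2, (1)–(2)]
[cite: GreenbergLNM1716, §3 Lemma 3.1 (T^{rank} ∣ char)] -/
theorem ClassX4Gord.isTorsion_and_le_lambdaInvariant_of_katoHalf
    (hK : Wuthrich2014.kato_halfEigenCharIdeal_dvd_cyclotomicPrime_of_surjective)
    (hmodD : nonempty_modularParametrizationData)
    (hX₁ : ClassX4Gord W₁ p) (he₁ : semistabilityIndex W₁ p = 2) (hsurj₁ : Surj W₁ p) {r₁ : ℕ}
    (hr₁ : r₁ ≤ W₁.mordellWeilRank)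
    {κ : ZpExtension ℚ p} {γ : absoluteGaloisGroup ℚ}
    (hκ : κ.IsCyclotomic) (hγ : κ.IsTopGenerator γ) (hγ' : IsCyclotomicVariable p γ)
    (D₁ : W₁.SelmerDualData κ γ) [Module.Finite (IwasawaAlgebra p) D₁.X] :
    D₁.IsTorsion ∧ (D₁.mu = 0 → r₁ ≤ lambdaInvariant p D₁.X) := by
  have hp2 : p ≠ 2 := hX₁.addv.1
  obtain ⟨V, iV, iVm, C, hV, hC⟩ := ClassX4Gord.exists_goodOrd_pStar_twist_model W₁ p hX₁ he₁
  haveI : NeZero (V.conductorNorm ℤ) := ⟨(V.conductorNorm_pos_holds).ne'⟩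
  obtain ⟨Dm⟩ := hmodD V
  obtain ⟨ϖ, hϖ⟩ := exists_periodRatio_parity (p := p) V Dm
  -- the `p`-adic tower of `E₁` from surj(p) (e = 2), moved to the twist model `V`
  have htowerV : ∀ n : ℕ, V.HasSurjectiveModNGaloisRep (p ^ n : ℕ) := fun n ↦
    (GaloisImage.hasSurjectiveModNGaloisRep_pow_iff_of_model_twist V p (pStar_ne_zero p) ⟨C, hC⟩ n).mp
      (hX₁.towerSurj_of_surj he₁ hsurj₁ n)
  -- torsion from Kato's divisibility on the good-ordinary branch (full-series brick)
  obtain ⟨hXt, -⟩ := isTorsion_and_exists_iota_eq_branch_of_katoComponent W₁ p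
    (Kato2004.charIdeal_dvd_padicLFunctionBranch_component_of_surjective_of_half hK)
    (padicValRat_j_nonneg_of_typeGOrd W₁ p hX₁.typeGOrd) hp2 V ⟨C, hC⟩ (Or.inl hV) htowerV hκ hγ hγ'
    Dm.isNewformOf D₁ ϖ hϖ
  refine ⟨hXt, fun hmu ↦ ?_⟩
  obtain ⟨fE₁, hchar, -⟩ := exists_charIdeal_eq_span_singleton p D₁
  have hfE : HasUnitContent fE₁ :=
    (GreenbergVatsal2000.mu_eq_zero_iff_hasUnitContent D₁ hXt hchar).mp hmu
  exact le_lambdaInvariant_of_le_mordellWeilRank hγ D₁ hXt hchar hfE (dvd_refl fE₁) hr₁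

end Summit.BirchSwinnertonDyer.Rank1Residual.Additive

/-! ### §2 MIXED pairs: `CongruentLambdaShift` and the `μ = 0` transfer, both directions -/

namespace Summit.BirchSwinnertonDyer.Rank1Residual.AdditivePotMult

open Summit.BirchSwinnertonDyer.Rank1Residual.Additive

section Mixed

variable {W₁ W₂ : WeierstrassCurve ℚ} [W₁.IsElliptic] [W₁.IsGloballyMinimal] [W₂.IsElliptic]
  [W₂.IsGloballyMinimal] {p : ℕ} [hp : Fact p.Prime]

/-- **(G-ord, `e = 2`) row, pot-mult partner: Route G's typed input `CongruentLambdaShift W₁ W₂ p e`,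
`e = Σ_{w∈Σ₀} (δ(E₂,w) − δ(E₁,w))`, from EPW + a PLAIN `TorsionIso`.** `E₁ = W₁` additive of type
(G)-ordinary with `semistabilityIndex W₁ p = 2`, `E₂ = W₂` potentially multiplicative at the same odd
`p`, `E₁[p]` irreducible, `TorsionIso W₁ W₂ p`, `Σ₀ ∌ p` outside which both are good. The ramified
ordinary lines and the line-respecting clause demanded by `hEPW` are C′'s
`exists_lines_matching_of_typeGOrd_potMult` at `v_p` (mod A40/A41 on the (M) member).
[cite: EmertonPollackWeston2006, Thm. 3.3.3 (2) (arXiv:math/0404484 p. 19), Lemma 5.1.5 (p. 30), pp. 2–3]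
[cite: GreenbergVatsal2000, Thm. (1.4) and §2 p. 26] [cite: SilvermanATAEC1994, Ch. V Thm. 5.3, Cor. 5.4] -/
theorem congruentLambdaShift_of_epw_of_typeGOrd_potMult
    (hEPW : muLambdaAlg_transfer_of_torsionIso_potOrd)
    (hT40 : Silverman1994_thmV53_tateUniformisation.{0})
    (hT41 : Silverman1994_thmV53_corV54_tateUniformisation.{0}) (hp2 : p ≠ 2)
    (hG₁ : TypeGOrd W₁ p) (hadd₁ : Addv W₁ p) (he₁ : semistabilityIndex W₁ p = 2)
    (hpm₂ : PotMult W₂ p) (hirr : W₁.HasIrreducibleModPGaloisRep p) (hT : TorsionIso W₁ W₂ p)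
    (S₀ : Finset (HeightOneSpectrum (𝓞 ℚ))) (hS₀ : ∀ w ∈ S₀, ((p : ℕ) : 𝓞 ℚ) ∉ w.asIdeal)
    (hS₁ : ∀ w : HeightOneSpectrum (𝓞 ℚ), w ∉ S₀ → ((p : ℕ) : 𝓞 ℚ) ∉ w.asIdeal →
      W₁.HasGoodReductionAt w)
    (hS₂ : ∀ w : HeightOneSpectrum (𝓞 ℚ), w ∉ S₀ → ((p : ℕ) : 𝓞 ℚ) ∉ w.asIdeal →
      W₂.HasGoodReductionAt w) :
    CongruentLambdaShift W₁ W₂ p (∑ w ∈ S₀, ((delta W₂ p w : ℤ) - (delta W₁ p w : ℤ))) := by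
  obtain ⟨v, hv⟩ := exists_place p
  obtain ⟨L₁, L₂, hL₁, hL₂, hmatch⟩ :=
    exists_lines_matching_of_typeGOrd_potMult hT40 hT41 hp2 hG₁ hadd₁ he₁ hpm₂ hv
  obtain ⟨e, he⟩ := hT
  exact congruentLambdaShift_of_epw W₁ W₂ p S₀ hEPW hp2 hv hL₁ hL₂ hirr ⟨e, he, hmatch e he⟩ hS₀ hS₁ hS₂

/-- **Pot-mult row, (G-ord, `e = 2`) partner: `CongruentLambdaShift W₁ W₂ p e` from EPW + a PLAIN
`TorsionIso`** (roles flipped: `E₁ = W₁` potentially multiplicative with `E₁[p]` irreducible,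
`E₂ = W₂` of type (G)-ordinary, additive, `semistabilityIndex W₂ p = 2`; lines by
`exists_lines_matching_of_potMult_typeGOrd`).
[cite: EmertonPollackWeston2006, Thm. 3.3.3 (2) (arXiv:math/0404484 p. 19), Lemma 5.1.5 (p. 30), pp. 2–3]
[cite: GreenbergVatsal2000, Thm. (1.4) and §2 p. 26] [cite: SilvermanATAEC1994, Ch. V Thm. 5.3, Cor. 5.4] -/
theorem congruentLambdaShift_of_epw_of_potMult_typeGOrd
    (hEPW : muLambdaAlg_transfer_of_torsionIso_potOrd)
    (hT40 : Silverman1994_thmV53_tateUniformisation.{0})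
    (hT41 : Silverman1994_thmV53_corV54_tateUniformisation.{0}) (hp2 : p ≠ 2)
    (hpm₁ : PotMult W₁ p) (hG₂ : TypeGOrd W₂ p) (hadd₂ : Addv W₂ p)
    (he₂ : semistabilityIndex W₂ p = 2) (hirr : W₁.HasIrreducibleModPGaloisRep p)
    (hT : TorsionIso W₁ W₂ p)
    (S₀ : Finset (HeightOneSpectrum (𝓞 ℚ))) (hS₀ : ∀ w ∈ S₀, ((p : ℕ) : 𝓞 ℚ) ∉ w.asIdeal)
    (hS₁ : ∀ w : HeightOneSpectrum (𝓞 ℚ), w ∉ S₀ → ((p : ℕ) : 𝓞 ℚ) ∉ w.asIdeal →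
      W₁.HasGoodReductionAt w)
    (hS₂ : ∀ w : HeightOneSpectrum (𝓞 ℚ), w ∉ S₀ → ((p : ℕ) : 𝓞 ℚ) ∉ w.asIdeal →
      W₂.HasGoodReductionAt w) :
    CongruentLambdaShift W₁ W₂ p (∑ w ∈ S₀, ((delta W₂ p w : ℤ) - (delta W₁ p w : ℤ))) := by
  obtain ⟨v, hv⟩ := exists_place p
  obtain ⟨L₁, L₂, hL₁, hL₂, hmatch⟩ :=
    exists_lines_matching_of_potMult_typeGOrd hT40 hT41 hp2 hpm₁ hG₂ hadd₂ he₂ hv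
  obtain ⟨e, he⟩ := hT
  exact congruentLambdaShift_of_epw W₁ W₂ p S₀ hEPW hp2 hv hL₁ hL₂ hirr ⟨e, he, hmatch e he⟩ hS₀ hS₁ hS₂

/-- **(G-ord, `e = 2`) row, pot-mult partner: EPW 3.3.2's `μ = 0` TRANSFER** — under the hypotheses of
`congruentLambdaShift_of_epw_of_typeGOrd_potMult`, for the cyclotomic data and torsion dual data
`D₁`, `D₂`: `μ(X(E₁)) = 0 ⟹ μ(X(E₂)) = 0`.
[cite: EmertonPollackWeston2006, Thm. 3.3.2 (arXiv:math/0404484 p. 19), pp. 2–3]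
[cite: GreenbergVatsal2000, Thm. (1.4) and §2 p. 26] [cite: SilvermanATAEC1994, Ch. V Thm. 5.3, Cor. 5.4] -/
theorem mu_eq_zero_of_epw_of_typeGOrd_potMult
    (hEPW : muLambdaAlg_transfer_of_torsionIso_potOrd)
    (hT40 : Silverman1994_thmV53_tateUniformisation.{0})
    (hT41 : Silverman1994_thmV53_corV54_tateUniformisation.{0}) (hp2 : p ≠ 2)
    (hG₁ : TypeGOrd W₁ p) (hadd₁ : Addv W₁ p) (he₁ : semistabilityIndex W₁ p = 2)
    (hpm₂ : PotMult W₂ p) (hirr : W₁.HasIrreducibleModPGaloisRep p) (hT : TorsionIso W₁ W₂ p)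
    (S₀ : Finset (HeightOneSpectrum (𝓞 ℚ))) (hS₀ : ∀ w ∈ S₀, ((p : ℕ) : 𝓞 ℚ) ∉ w.asIdeal)
    (hS₁ : ∀ w : HeightOneSpectrum (𝓞 ℚ), w ∉ S₀ → ((p : ℕ) : 𝓞 ℚ) ∉ w.asIdeal →
      W₁.HasGoodReductionAt w)
    (hS₂ : ∀ w : HeightOneSpectrum (𝓞 ℚ), w ∉ S₀ → ((p : ℕ) : 𝓞 ℚ) ∉ w.asIdeal →
      W₂.HasGoodReductionAt w)
    {κ : ZpExtension ℚ p} {γ : absoluteGaloisGroup ℚ} (hκ : κ.IsCyclotomic)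
    (hγ : κ.IsTopGenerator γ) (hγ' : IsCyclotomicVariable p γ)
    (D₁ : W₁.SelmerDualData κ γ) (D₂ : W₂.SelmerDualData κ γ)
    [Module.Finite (IwasawaAlgebra p) D₁.X] [Module.Finite (IwasawaAlgebra p) D₂.X]
    (hX₁t : D₁.IsTorsion) (hX₂t : D₂.IsTorsion) (hμ₁ : D₁.mu = 0) : D₂.mu = 0 := by
  obtain ⟨v, hv⟩ := exists_place p
  obtain ⟨L₁, L₂, hL₁, hL₂, hmatch⟩ :=
    exists_lines_matching_of_typeGOrd_potMult hT40 hT41 hp2 hG₁ hadd₁ he₁ hpm₂ hv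
  obtain ⟨e, he⟩ := hT
  exact mu_eq_zero_of_epw W₁ W₂ p S₀ hEPW hp2 hv hL₁ hL₂ hirr ⟨e, he, hmatch e he⟩ hS₀ hS₁ hS₂ hκ hγ hγ'
    D₁ D₂ hX₁t hX₂t hμ₁

/-- **Pot-mult row, (G-ord, `e = 2`) partner: EPW 3.3.2's `μ = 0` TRANSFER** (roles flipped).
[cite: EmertonPollackWeston2006, Thm. 3.3.2 (arXiv:math/0404484 p. 19), pp. 2–3]
[cite: GreenbergVatsal2000, Thm. (1.4) and §2 p. 26] [cite: SilvermanATAEC1994, Ch. V Thm. 5.3, Cor. 5.4] -/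
theorem mu_eq_zero_of_epw_of_potMult_typeGOrd
    (hEPW : muLambdaAlg_transfer_of_torsionIso_potOrd)
    (hT40 : Silverman1994_thmV53_tateUniformisation.{0})
    (hT41 : Silverman1994_thmV53_corV54_tateUniformisation.{0}) (hp2 : p ≠ 2)
    (hpm₁ : PotMult W₁ p) (hG₂ : TypeGOrd W₂ p) (hadd₂ : Addv W₂ p)
    (he₂ : semistabilityIndex W₂ p = 2) (hirr : W₁.HasIrreducibleModPGaloisRep p)
    (hT : TorsionIso W₁ W₂ p)
    (S₀ : Finset (HeightOneSpectrum (𝓞 ℚ))) (hS₀ : ∀ w ∈ S₀, ((p : ℕ) : 𝓞 ℚ) ∉ w.asIdeal)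
    (hS₁ : ∀ w : HeightOneSpectrum (𝓞 ℚ), w ∉ S₀ → ((p : ℕ) : 𝓞 ℚ) ∉ w.asIdeal →
      W₁.HasGoodReductionAt w)
    (hS₂ : ∀ w : HeightOneSpectrum (𝓞 ℚ), w ∉ S₀ → ((p : ℕ) : 𝓞 ℚ) ∉ w.asIdeal →
      W₂.HasGoodReductionAt w)
    {κ : ZpExtension ℚ p} {γ : absoluteGaloisGroup ℚ} (hκ : κ.IsCyclotomic)
    (hγ : κ.IsTopGenerator γ) (hγ' : IsCyclotomicVariable p γ)
    (D₁ : W₁.SelmerDualData κ γ) (D₂ : W₂.SelmerDualData κ γ)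
    [Module.Finite (IwasawaAlgebra p) D₁.X] [Module.Finite (IwasawaAlgebra p) D₂.X]
    (hX₁t : D₁.IsTorsion) (hX₂t : D₂.IsTorsion) (hμ₁ : D₁.mu = 0) : D₂.mu = 0 := by
  obtain ⟨v, hv⟩ := exists_place p
  obtain ⟨L₁, L₂, hL₁, hL₂, hmatch⟩ :=
    exists_lines_matching_of_potMult_typeGOrd hT40 hT41 hp2 hpm₁ hG₂ hadd₂ he₂ hv
  obtain ⟨e, he⟩ := hT
  exact mu_eq_zero_of_epw W₁ W₂ p S₀ hEPW hp2 hv hL₁ hL₂ hirr ⟨e, he, hmatch e he⟩ hS₀ hS₁ hS₂ hκ hγ hγ'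
    D₁ D₂ hX₁t hX₂t hμ₁

/-- **X4(M) row with an X4♯(G-ord) ∩ `I₀*` congruent partner: `CongruentLambdaShift W₁ W₂ p e`** from
EPW + `TorsionIso W₁ W₂ p` + the class binders (`E₁[p]` irreducible is READ OFF X4). Nothing booked.
[cite: EmertonPollackWeston2006, Thm. 3.3.3 (2) (arXiv:math/0404484 p. 19), Lemma 5.1.5 (p. 30)]
[cite: GreenbergVatsal2000, Thm. (1.4)] [cite: SilvermanATAEC1994, Ch. V Thm. 5.3, Cor. 5.4] -/
theorem ClassX4M.congruentLambdaShift_of_epw_of_torsionIso_gord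
    (hEPW : muLambdaAlg_transfer_of_torsionIso_potOrd)
    (hT40 : Silverman1994_thmV53_tateUniformisation.{0})
    (hT41 : Silverman1994_thmV53_corV54_tateUniformisation.{0})
    (hX₁ : ClassX4M W₁ p) (hX₂ : ClassX4Gord W₂ p) (he₂ : semistabilityIndex W₂ p = 2)
    (hT : TorsionIso W₁ W₂ p)
    (S₀ : Finset (HeightOneSpectrum (𝓞 ℚ))) (hS₀ : ∀ w ∈ S₀, ((p : ℕ) : 𝓞 ℚ) ∉ w.asIdeal)
    (hS₁ : ∀ w : HeightOneSpectrum (𝓞 ℚ), w ∉ S₀ → ((p : ℕ) : 𝓞 ℚ) ∉ w.asIdeal →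
      W₁.HasGoodReductionAt w)
    (hS₂ : ∀ w : HeightOneSpectrum (𝓞 ℚ), w ∉ S₀ → ((p : ℕ) : 𝓞 ℚ) ∉ w.asIdeal →
      W₂.HasGoodReductionAt w) :
    CongruentLambdaShift W₁ W₂ p (∑ w ∈ S₀, ((delta W₂ p w : ℤ) - (delta W₁ p w : ℤ))) :=
  congruentLambdaShift_of_epw_of_potMult_typeGOrd hEPW hT40 hT41 hX₁.p_ne_two
    (ClassX4M.potMult W₁ p hX₁) hX₂.typeGOrd hX₂.addv.2 he₂ hX₁.irr hT S₀ hS₀ hS₁ hS₂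

/-- **X4(M) row with an X4♯(G-ord) ∩ `I₀*` congruent partner: `μ(X(E₁)) = 0 ⟹ μ(X(E₂)) = 0`**
(EPW Thm. 3.3.2) for torsion cyclotomic dual data. Nothing booked.
[cite: EmertonPollackWeston2006, Thm. 3.3.2 (arXiv:math/0404484 p. 19)] [cite: GreenbergVatsal2000, Thm. (1.4)]
[cite: SilvermanATAEC1994, Ch. V Thm. 5.3, Cor. 5.4] -/
theorem ClassX4M.mu_eq_zero_of_epw_of_torsionIso_gord
    (hEPW : muLambdaAlg_transfer_of_torsionIso_potOrd)
    (hT40 : Silverman1994_thmV53_tateUniformisation.{0})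
    (hT41 : Silverman1994_thmV53_corV54_tateUniformisation.{0})
    (hX₁ : ClassX4M W₁ p) (hX₂ : ClassX4Gord W₂ p) (he₂ : semistabilityIndex W₂ p = 2)
    (hT : TorsionIso W₁ W₂ p)
    (S₀ : Finset (HeightOneSpectrum (𝓞 ℚ))) (hS₀ : ∀ w ∈ S₀, ((p : ℕ) : 𝓞 ℚ) ∉ w.asIdeal)
    (hS₁ : ∀ w : HeightOneSpectrum (𝓞 ℚ), w ∉ S₀ → ((p : ℕ) : 𝓞 ℚ) ∉ w.asIdeal →
      W₁.HasGoodReductionAt w)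
    (hS₂ : ∀ w : HeightOneSpectrum (𝓞 ℚ), w ∉ S₀ → ((p : ℕ) : 𝓞 ℚ) ∉ w.asIdeal →
      W₂.HasGoodReductionAt w)
    {κ : ZpExtension ℚ p} {γ : absoluteGaloisGroup ℚ} (hκ : κ.IsCyclotomic)
    (hγ : κ.IsTopGenerator γ) (hγ' : IsCyclotomicVariable p γ)
    (D₁ : W₁.SelmerDualData κ γ) (D₂ : W₂.SelmerDualData κ γ)
    [Module.Finite (IwasawaAlgebra p) D₁.X] [Module.Finite (IwasawaAlgebra p) D₂.X]
    (hX₁t : D₁.IsTorsion) (hX₂t : D₂.IsTorsion) (hμ₁ : D₁.mu = 0) : D₂.mu = 0 :=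
  mu_eq_zero_of_epw_of_potMult_typeGOrd hEPW hT40 hT41 hX₁.p_ne_two (ClassX4M.potMult W₁ p hX₁)
    hX₂.typeGOrd hX₂.addv.2 he₂ hX₁.irr hT S₀ hS₀ hS₁ hS₂ hκ hγ hγ' D₁ D₂ hX₁t hX₂t hμ₁

end Mixed

/-! ### §3(M) The budget of an X4(M) row from an X4♯(G-ord) ∩ `I₀*` ∧ surj partner — partner input CONCRETE -/

section BudgetM

variable {W W₁ : WeierstrassCurve ℚ} [W.IsElliptic] [W.IsGloballyMinimal] [W₁.IsElliptic]
  [W₁.IsGloballyMinimal] {p : ℕ} [hp : Fact p.Prime]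

/-- **The Route-G budget of an X4(M) row from an X4♯(G-ord) ∩ `I₀*` ∧ surj(p) congruent partner of
rank `≥ r₁` — lines, matching AND the partner input discharged.** `E = W` X4(M) at the odd prime `p`;
partner `E₁ = W₁` in X4♯(G-ord) with `semistabilityIndex W₁ p = 2`, `ρ̄_{E₁,p}` onto and
`r₁ ≤ rank E₁(ℚ)` (§1: torsion and `μ = 0 ⟹ r₁ ≤ λ` from Kato alone); a PLAIN `Γ_ℚ`-equivariant
`E[p] ≃+ E₁[p]`; `Σ₀ ∌ p` outside which both are good. Then `BudgetLeLambdaAt p W b` for every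
`b ≤ r₁ + Σ_{w∈Σ₀} (δ(E₁,w) − δ(E,w))` (C′ §4 `ClassX4M.budgetLeLambdaAt_of_epw_of_gordTypePartner_of_congr`
with `h₁ :=` §1). Named facts as hypotheses: `hEPW`, `hK`, `hmodD`, `hT40`, `hT41`. PER PAIR; X4(M)
stays CONSTRUCTION-SHAPED; nothing booked.
[cite: EmertonPollackWeston2006, Thm. 3.3.2, Thm. 3.3.3 (2) (arXiv:math/0404484 p. 19), Lemma 5.1.5 (p. 30) and pp. 2–3]
[cite: Kato2004Asterisque, Thm. 17.4 (3) (p. 273)] [cite: SilvermanATAEC1994, Ch. V Thm. 5.3, Cor. 5.4] -/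
theorem ClassX4M.budgetLeLambdaAt_of_epw_of_gordPartner_of_congr
    (hEPW : muLambdaAlg_transfer_of_torsionIso_potOrd)
    (hK : Wuthrich2014.kato_halfEigenCharIdeal_dvd_cyclotomicPrime_of_surjective)
    (hmodD : nonempty_modularParametrizationData)
    (hT40 : Silverman1994_thmV53_tateUniformisation.{0})
    (hT41 : Silverman1994_thmV53_corV54_tateUniformisation.{0})
    (hX : ClassX4M W p) (hX₁ : ClassX4Gord W₁ p) (he₁ : semistabilityIndex W₁ p = 2)
    (hsurj₁ : Surj W₁ p) {r₁ : ℕ} (hr₁ : r₁ ≤ W₁.mordellWeilRank)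
    (hcong : ∃ e : geomTorsion W (p : ℤ) ≃+ geomTorsion W₁ (p : ℤ),
      ∀ (σ : absoluteGaloisGroup ℚ) (P : geomTorsion W (p : ℤ)), e (σ • P) = σ • e P)
    (S₀ : Finset (HeightOneSpectrum (𝓞 ℚ))) (hS₀ : ∀ w ∈ S₀, ((p : ℕ) : 𝓞 ℚ) ∉ w.asIdeal)
    (hS : ∀ w : HeightOneSpectrum (𝓞 ℚ), w ∉ S₀ → ((p : ℕ) : 𝓞 ℚ) ∉ w.asIdeal →
      W.HasGoodReductionAt w)
    (hS₁ : ∀ w : HeightOneSpectrum (𝓞 ℚ), w ∉ S₀ → ((p : ℕ) : 𝓞 ℚ) ∉ w.asIdeal →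
      W₁.HasGoodReductionAt w)
    {b : ℕ} (hb : (b : ℤ) ≤ r₁ + ∑ w ∈ S₀, ((delta W₁ p w : ℤ) - (delta W p w : ℤ))) :
    BudgetLeLambdaAt p W b := by
  obtain ⟨v, hv⟩ := exists_place p
  exact hX.budgetLeLambdaAt_of_epw_of_gordTypePartner_of_congr hEPW hT40 hT41 hX₁.typeGOrd hX₁.addv.2
    he₁ hv hcong S₀ hS₀ hS hS₁
    (fun hκ hγ hγ' D₁ _ ↦
      hX₁.isTorsion_and_le_lambdaInvariant_of_katoHalf hK hmodD he₁ hsurj₁ hr₁ hκ hγ hγ' D₁) hb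

end BudgetM

end Summit.BirchSwinnertonDyer.Rank1Residual.AdditivePotMult

end
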